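import Mathlib
import HarnessLib
import Summits.ValiantsHypothesis.ValiantsHypothesis.Theses.NewtonFrames
import Literature.Computability.AlgebraicComplexity.NewtonPolygonTauProductBounds

/-!
# Route NewtonFrames — crux `ShallowChains` (stmt-ValiantsHypothesis-7365) PROVED

The crux `Summit.ValiantsHypothesis.ValiantsHypothesis.Theses.NewtonFrames.ShallowChains`
(rank-6 crux of route NewtonFrames; the coefficient-free core of `ProductMinusPoints`; "NEW as a
statement, not in print; OPEN for m ≥ 3" at grounding 2026-08-15) states: there is `c` such that for
all `t`-sets `A_0, …, A_{m-1} ⊂ ℕ²` with sumset `S = {Σ_j a_j}` and every finite `C ⊂ ℕ²`, the convex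
hull of `S ∖ C` (read in `ℝ²`) has at most `(m + t + |C| + 2)^c` extreme points.

PROOF (the one-step exchange argument of the planner's evidence note of 2026-08-16, made exact with
the Literature toolkit `Literature/Computability/AlgebraicComplexity/NewtonPolygonTauProductBounds.lean`,
KPTT 2015 §2 / planar Minkowski sums): let `v` be a vertex of `conv(S ∖ C)`. By
`KPTT.PlanarMinkowski.exists_chart_injOn` there is a chart weight `w = (±1, t)` exposing `v` strictly
on `S ∖ C` and injective on every `A_j`, so every `A_j` has a strict `w`-top `a_j`
(`exists_isStrictTop_of_injOn`) and `Σ_j a_j` is the strict `w`-top of `S` (`IsStrictTop.fintype_sum`,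
`image_natEmb_sumset`). Write `v = Σ_j x_j`. Either `x = a` — then `v` is a vertex of `conv S`, of
which there are `≤ Σ_j #A_j ≤ m t` (`ncard_extremePoints_sumset_le_sum_card`) — or some `x_j ≠ a_j`,
and exchanging `x_j` for `a_j` gives a point `s' ∈ S` of larger weight, hence NOT in `S ∖ C` (where `v`
is the strict maximum), i.e. `s' ∈ C`; then `v = s' + x_j - a_j` is determined by
`(s', j, x_j, a_j) ∈ C × [m] × A_j × A_j`: at most `|C| · m · t²` such points. Total
`≤ m t + |C| m t² ≤ (m + t + |C| + 2)^5`, so `c = 5`.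

Text prepared and farm-checked (rc 0, axioms propext / Classical.choice / Quot.sound, by concatenation
with the Literature file before it landed) by val-lit-t17 g6 (literature seat, which does not file
Summits proofs); to be filed by a prover seat with `--workitem stmt-ValiantsHypothesis-7365` once
`NewtonPolygonTauProductBounds.lean` (p507787 + its theorem-only v2 append `IsStrictTop.fintype_sum`)
is in the tree. HONEST FRAMING: elementary planar convex geometry; closing this crux says nothing
about `ProductMinusPoints` with cancellations, about Conjecture 1 of KPTT, or about `VP ≠ VNP`.
-/

set_option linter.dupNamespace false

noncomputable section

namespace Summit.ValiantsHypothesis.ValiantsHypothesis.Theorems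

open Literature.Computability.AlgebraicComplexity
open Literature.Computability.AlgebraicComplexity.KPTT.PlanarMinkowski
open Matrix Finset
open scoped Pointwise

/-- **Shallow points of a planar Minkowski sum** (the exchange argument): for finite `A_j ⊂ ℕ²`
(`j < m`, `m ≥ 1`, all nonempty) with sumset `S` and any finite `C`, every vertex of
`conv(S ∖ C)` is either a vertex of `conv S` or of the form `s' + x - a` with `s' ∈ C`, `x, a ∈ A_j`
for some `j`. -/
theorem ShallowChains.extremePoints_subset {m : ℕ} (A : Fin m → Finset (Fin 2 →₀ ℕ))
    (hA : ∀ j, (A j).Nonempty) (C : Finset (Fin 2 →₀ ℕ)) :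
    let emb : (Fin 2 →₀ ℕ) → (Fin 2 → ℝ) := fun e i => ((e i : ℕ) : ℝ)
    let S : Finset (Fin 2 →₀ ℕ) := (Fintype.piFinset A).image fun a => ∑ j, a j
    Set.extremePoints ℝ (convexHull ℝ (emb '' ((S \ C : Finset (Fin 2 →₀ ℕ)) : Set (Fin 2 →₀ ℕ)))) ⊆
      Set.extremePoints ℝ (convexHull ℝ (emb '' (S : Set (Fin 2 →₀ ℕ)))) ∪
        ↑((C ×ˢ (Finset.univ : Finset (Fin m))).biUnion fun p =>
          ((A p.2) ×ˢ (A p.2)).image fun q => emb p.1 + emb q.1 - emb q.2) := by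
  classical
  intro emb S v hv
  -- the vertex `v` and the finite planar sets
  set F : Finset (Fin 2 → ℝ) := (S \ C).image emb with hF
  have hFv : v ∈ (convexHull ℝ (F : Set (Fin 2 → ℝ))).extremePoints ℝ := by
    rwa [hF, Finset.coe_image]
  -- a generic chart weight exposing `v`, injective on every `A j`
  obtain ⟨σ, t, -, htop, hinj⟩ := exists_chart_injOn (Finset.univ : Finset (Fin m))
    (fun j => (A j).image emb) hFv
  set w : Fin 2 → ℝ := ![σ, t] with hw
  -- strict tops `a j` of the summands
  have hex : ∀ j, ∃ y, IsStrictTop w ((A j).image emb) y := fun j =>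
    exists_isStrictTop_of_injOn ((hA j).image emb) (hinj j (Finset.mem_univ _))
  choose top htop' using hex
  obtain ⟨a, ha, hta⟩ : ∃ a : Fin m → (Fin 2 →₀ ℕ), (∀ j, a j ∈ A j) ∧ ∀ j, emb (a j) = top j := by
    have : ∀ j, ∃ aj ∈ A j, emb aj = top j := fun j => by
      simpa [Finset.mem_image] using (htop' j).1
    choose a ha hta using this
    exact ⟨a, ha, hta⟩
  -- `v = emb (Σ x_j)` with `Σ x_j ∉ C`
  have hvF : v ∈ F := htop.1
  rw [hF, Finset.mem_image] at hvF
  obtain ⟨s, hs, rfl⟩ := hvF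
  rw [Finset.mem_sdiff] at hs
  obtain ⟨hsS, hsC⟩ := hs
  obtain ⟨x, hx, rfl⟩ := Finset.mem_image.1 hsS
  rw [Fintype.mem_piFinset] at hx
  have hemb_sum : ∀ y : Fin m → (Fin 2 →₀ ℕ), emb (∑ j, y j) = ∑ j, emb (y j) := by
    intro y; ext i; simp [emb]
  by_cases hall : ∀ j, x j = a j
  · -- the corner: a vertex of `conv S`
    left
    have hsum : IsStrictTop w (∑ j, (A j).image emb) (∑ j, top j) :=
      IsStrictTop.fintype_sum htop'
    have hS : (∑ j, (A j).image emb : Finset (Fin 2 → ℝ)) = S.image emb := by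
      rw [← image_natEmb_sumset]
    have heq : (∑ j, top j) = emb (∑ j, x j) := by
      rw [hemb_sum]; exact Finset.sum_congr rfl fun j _ => by rw [← hta j, hall j]
    rw [hS, heq] at hsum
    have := hsum.mem_extremePoints
    rwa [Finset.coe_image] at this
  · -- exchange one coordinate
    right
    push Not at hall
    obtain ⟨j, hj⟩ := hall
    -- the exchanged tuple lands in `C`
    let x' : Fin m → (Fin 2 →₀ ℕ) := Function.update x j (a j)
    have hxj : x' j = a j := by simp [x']
    have hxi : ∀ i, i ≠ j → x' i = x i := fun i hi => by simp [x', Function.update_of_ne hi]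
    have hx'S : (∑ i, x' i) ∈ S := Finset.mem_image.2 ⟨x', Fintype.mem_piFinset.2 fun i => by
      by_cases hij : i = j
      · rw [hij, hxj]; exact ha j
      · rw [hxi i hij]; exact hx i, rfl⟩
    have hrest : ∑ i ∈ Finset.univ.erase j, emb (x' i) = ∑ i ∈ Finset.univ.erase j, emb (x i) :=
      Finset.sum_congr rfl fun i hi => by rw [hxi i (Finset.ne_of_mem_erase hi)]
    have hlt : w ⬝ᵥ emb (∑ i, x i) < w ⬝ᵥ emb (∑ i, x' i) := by
      rw [hemb_sum, hemb_sum, ← Finset.add_sum_erase _ _ (Finset.mem_univ j),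
        ← Finset.add_sum_erase _ (fun i => emb (x' i)) (Finset.mem_univ j), dotProduct_add,
        dotProduct_add, hrest, hxj]
      have hne : emb (x j) ≠ emb (a j) := fun h => hj (by
        ext i
        have hi := congr_fun h i
        simp only [emb, Nat.cast_inj] at hi
        exact hi)
      have := (htop' j).lt (Finset.mem_image_of_mem _ (hx j)) (by rw [← hta j]; exact hne)
      rw [hta j]
      linarith
    have hx'C : (∑ i, x' i) ∈ C := by
      by_contra hnot
      have hmem : emb (∑ i, x' i) ∈ F := by
        rw [hF]; exact Finset.mem_image_of_mem _ (Finset.mem_sdiff.2 ⟨hx'S, hnot⟩)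
      have hne : emb (∑ i, x' i) ≠ emb (∑ i, x i) := fun h => by rw [h] at hlt; exact lt_irrefl _ hlt
      exact lt_asymm hlt (htop.lt hmem hne)
    -- bookkeeping: `v = emb s' + emb x_j - emb a_j`
    rw [Finset.coe_biUnion, Set.mem_iUnion₂]
    refine ⟨(∑ i, x' i, j), Finset.mem_product.2 ⟨hx'C, Finset.mem_univ _⟩, ?_⟩
    rw [Finset.coe_image]
    refine ⟨(x j, a j), Finset.mem_coe.2 (Finset.mem_product.2 ⟨hx j, ha j⟩), ?_⟩
    show emb (∑ i, x' i) + emb (x j) - emb (a j) = emb (∑ i, x i)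
    rw [hemb_sum, hemb_sum, ← Finset.add_sum_erase _ (fun i => emb (x' i)) (Finset.mem_univ j),
      ← Finset.add_sum_erase (Finset.univ) (fun i => emb (x i)) (Finset.mem_univ j), hrest, hxj]
    abel

/-- **`ShallowChains` (stmt-ValiantsHypothesis-7365) holds with `c = 5`**: for `t`-sets
`A_0, …, A_{m-1} ⊂ ℕ²` with sumset `S` and every finite `C`, `conv(S ∖ C)` has at most
`m t + |C| m t² ≤ (m + t + |C| + 2)^5` vertices. -/
theorem shallowChains_proof : Summit.ValiantsHypothesis.ValiantsHypothesis.Theses.NewtonFrames.ShallowChains := by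
  classical
  refine ⟨5, fun m t A C hA => ?_⟩
  set emb : (Fin 2 →₀ ℕ) → (Fin 2 → ℝ) := fun e i => ((e i : ℕ) : ℝ) with hemb
  set S : Finset (Fin 2 →₀ ℕ) := (Fintype.piFinset A).image fun a => ∑ j, a j with hSdef
  have hbase : 2 ≤ m + t + C.card + 2 := by omega
  -- degenerate cases: `m = 0` or an empty summand
  by_cases hm : m = 0
  · subst hm
    refine (Set.ncard_le_ncard extremePoints_convexHull_subset (Set.toFinite _)).trans ?_
    refine (Set.ncard_image_le (Finset.finite_toSet _)).trans ?_
    rw [Set.ncard_coe_finset]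
    refine (Finset.card_le_card Finset.sdiff_subset).trans (Finset.card_image_le.trans ?_)
    have h1 : (Fintype.piFinset A).card ≤ 1 :=
      Finset.card_le_one.2 fun a _ b _ => funext fun j => j.elim0
    exact h1.trans (Nat.one_le_pow _ _ (by omega))
  by_cases he : ∃ j, A j = ∅
  · obtain ⟨j, hj⟩ := he
    have : Fintype.piFinset A = ∅ := Fintype.piFinset_eq_empty.2 ⟨j, hj⟩
    have hS0 : S = ∅ := by rw [hSdef, this, Finset.image_empty]
    simp [hS0]
  have hA' : ∀ j, (A j).Nonempty := fun j => Finset.nonempty_iff_ne_empty.2 fun h => he ⟨j, h⟩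
  -- the exchange inclusion and the two counts
  have hsub := ShallowChains.extremePoints_subset A hA' C
  simp only at hsub
  have hfin₁ : (Set.extremePoints ℝ (convexHull ℝ (emb '' (S : Set (Fin 2 →₀ ℕ))))).Finite :=
    ((S.finite_toSet).image _).subset extremePoints_convexHull_subset
  have h1 : (Set.extremePoints ℝ (convexHull ℝ (emb '' (S : Set (Fin 2 →₀ ℕ))))).ncard ≤ m * t := by
    refine (ncard_extremePoints_sumset_le_sum_card hm A hA').trans ?_
    calc ∑ j, (A j).card ≤ ∑ _j : Fin m, t := Finset.sum_le_sum fun j _ => hA j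
      _ = m * t := by simp
  have h2 : ((C ×ˢ (Finset.univ : Finset (Fin m))).biUnion fun p =>
      ((A p.2) ×ˢ (A p.2)).image fun q => emb p.1 + emb q.1 - emb q.2).card ≤ C.card * m * (t * t) := by
    refine Finset.card_biUnion_le.trans ?_
    calc ∑ p ∈ C ×ˢ (Finset.univ : Finset (Fin m)),
          (((A p.2) ×ˢ (A p.2)).image fun q => emb p.1 + emb q.1 - emb q.2).card
        ≤ ∑ _p ∈ C ×ˢ (Finset.univ : Finset (Fin m)), t * t :=
          Finset.sum_le_sum fun p _ => Finset.card_image_le.trans (by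
            rw [Finset.card_product]; exact Nat.mul_le_mul (hA _) (hA _))
      _ = C.card * m * (t * t) := by simp [Finset.card_product, mul_assoc]
  calc (Set.extremePoints ℝ (convexHull ℝ (emb '' ((S \ C : Finset (Fin 2 →₀ ℕ)) : Set (Fin 2 →₀ ℕ))))).ncard
      ≤ (Set.extremePoints ℝ (convexHull ℝ (emb '' (S : Set (Fin 2 →₀ ℕ))))).ncard +
          ((C ×ˢ (Finset.univ : Finset (Fin m))).biUnion fun p =>
            ((A p.2) ×ˢ (A p.2)).image fun q => emb p.1 + emb q.1 - emb q.2).card := by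
        rw [← Set.ncard_coe_finset]
        exact (Set.ncard_le_ncard hsub (hfin₁.union (Finset.finite_toSet _))).trans
          (Set.ncard_union_le _ _)
    _ ≤ m * t + C.card * m * (t * t) := add_le_add h1 h2
    _ ≤ (m + t + C.card + 2) ^ 5 := by
        have hb2 : m * t ≤ (m + t + C.card + 2) ^ 2 := by nlinarith
        have hb4 : C.card * m * (t * t) ≤ (m + t + C.card + 2) ^ 4 := by
          have e1 : C.card ≤ m + t + C.card + 2 := by omega
          have e2 : m ≤ m + t + C.card + 2 := by omega
          have e3 : t ≤ m + t + C.card + 2 := by omega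
          calc C.card * m * (t * t) ≤ (m + t + C.card + 2) * (m + t + C.card + 2) *
              ((m + t + C.card + 2) * (m + t + C.card + 2)) :=
                Nat.mul_le_mul (Nat.mul_le_mul e1 e2) (Nat.mul_le_mul e3 e3)
            _ = (m + t + C.card + 2) ^ 4 := by ring
        have hp2 : (m + t + C.card + 2) ^ 2 ≤ (m + t + C.card + 2) ^ 4 :=
          Nat.pow_le_pow_right (by omega) (by norm_num)
        have hp5 : 2 * (m + t + C.card + 2) ^ 4 ≤ (m + t + C.card + 2) ^ 5 := by
          rw [pow_succ]
          nlinarith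
        omega

end Summit.ValiantsHypothesis.ValiantsHypothesis.Theorems

end
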